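import Literature.NumberTheory.EllipticCurves.H1CorestrictionIndexTwo
import Literature.NumberTheory.EllipticCurves.IwasawaSelmerProofs
import HarnessLib

/-!
# Route `SignedLowerHalves`, crux L `SmallImageLowerHalfBothSigns` (stmt-BirchSwinnertonDyer-23599), line `rtt_w3` v10 — brick D2 of COUNT_π
# (memo `Lines/rtt_w3-BRIEF-E1b-g6.md` §9.3, route D): the EIGEN-DECOMPOSITION of `H¹(N, M)` along two complementary `N`-equivariant idempotents
# `e₁, e₂` of `M` that an element `c` of the ambient group SWAPS — the `c_*`-invariant classes are exactly `η + c_* η`, `η ∈ (e₁)_* H¹(N, M)`,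
# and `ξ ↦ (e₁)_* ξ` is injective on them. With D1 (`H¹(G, M) ≅ H¹(N, M)^{c_*}`, p763571) this is «`H¹(Γ_{ℚ_n}, W[p] ⊗ k_S) ≅ H¹(Γ_{K_n}, L_θ)`»
# read INSIDE `H¹(Γ_{K_n}, W[p] ⊗ k_S)` through the eigenline projections of `…RttCharRoadE1Eigenlines` (-w3 g16) — no `Coind`, no Shapiro.

LEAD `cruxlead-stmt-BirchSwinnertonDyer-23599` g6 (cell `bsd-ssimc`; `--supports stmt-BirchSwinnertonDyer-23599 --as helper`). THEOREMS ONLY (no definition,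
no named fact, no instance, no `sorry`); generic continuous group cohomology on the tree's `subgroupH1` / `resH1Hom` / `conjH1`. BSD / crux L / COUNT
are NOT proved here.

WHAT (`N ≤ G` normal, `M` a discrete `G`-module, `e e' e₁ e₂ : M →+ M` additive maps commuting with `N`; `(e)_* := resH1Hom id e`):
* §1 functoriality in the coefficients at fixed group: `pushH1_oneCocycleClass` (`(e)_*[f] = [e ∘ f]`), `pushH1_add`, `pushH1_id_apply`, `pushH1_comp_apply`,
  `pushH1_zero_of_comp_eq_zero`; ★ `conjH1_pushH1` — if `e' (c • m) = c • e m` then `c_* ∘ (e)_* = (e')_* ∘ c_*` (the twisted naturality).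
* §2 ★ `eq_pushH1_add_conjH1_pushH1_of_conjH1_eq` — for complementary `e₁ + e₂ = id` swapped by `c` (`e₂ (c•m) = c • e₁ m`), every `c_*`-FIXED class is
  `ξ = (e₁)_* ξ + c_* ((e₁)_* ξ)`; ★ `eq_zero_of_conjH1_eq_of_pushH1_eq_zero` (injectivity of `ξ ↦ (e₁)_* ξ` on the fixed classes);
  ★ `conjH1_add_eq_of_pushH1` / `pushH1_add_conjH1_eq` — conversely, for `η ∈ range (e₁)_*`, `ξ := η + c_* η` is `c_*`-fixed (needs `c² ∈ N`: inner
  automorphisms act trivially, `conjH1_of_mem_holds`) and `(e₁)_* ξ = η` (needs `e₂ ∘ e₁ = 0` and the second swap `e₁ (c•m) = c • e₂ m`).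
So `{ξ | c_* ξ = ξ} ≃ range (e₁)_*` by `ξ ↦ (e₁)_* ξ`, `η ↦ η + c_* η`.

References: [SerreGaloisCohomology1997] I §2.5 (the action of `G/N` on `H¹(N, M)`), I §5.8; [NeukirchSchmidtWingberg2008] I §5, (1.6.3); Brown, *Cohomology of
Groups* III.8 (cohomology of a direct sum) [folklore].
-/

set_option autoImplicit false
set_option linter.dupNamespace false -- D-0017: single-problem summit, the namespace repeats the problem name by design
noncomputable section

open scoped Classical

universe u

namespace Summit.BirchSwinnertonDyer.BirchSwinnertonDyer.Theorems.SmallImageCharSignedSelmer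

open Literature.NumberTheory.EllipticCurves Literature.NumberTheory.GaloisRepresentations

variable {G : Type u} [Group G] [TopologicalSpace G] [IsTopologicalGroup G] {N : Subgroup G}
  {M : Type u} [AddCommGroup M] [DistribMulAction G M] [TopologicalSpace M] [DiscreteTopology M]

/-! ## §1. `(e)_* = resH1Hom id e` for an `N`-equivariant additive `e : M → M` -/

/-- **`(e)_*[f] = [e ∘ f]`** for an `N`-equivariant additive endomorphism `e` of the coefficients. [cite: SerreGaloisCohomology1997, I §2.4] -/
theorem pushH1_oneCocycleClass (e : M →+ M) (he : ∀ (x : N) (m : M), e (x • m) = x • e m)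
    (f : contOneCocycles (discreteTopRep N M)) :
    ∃ g : contOneCocycles (discreteTopRep N M),
      resH1Hom (ContinuousMonoidHom.id N) e he (oneCocycleClass _ f) = oneCocycleClass _ g ∧ ∀ x : N, g.1 x = e (f.1 x) :=
  ⟨_, map_oneCocycleClass (X := discreteTopRep N M) (Y := discreteTopRep N M) (ContinuousMonoidHom.id N)
    (resHomOfEquivariant (ContinuousMonoidHom.id N) e he) f, fun _ ↦ rfl⟩

/-- `(e + e')_* = (e)_* + (e')_*` (pointwise on cocycles). [cite: SerreGaloisCohomology1997, I §2.4] -/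
theorem pushH1_add_apply (e e' : M →+ M) (he : ∀ (x : N) (m : M), e (x • m) = x • e m)
    (he' : ∀ (x : N) (m : M), e' (x • m) = x • e' m) (hee' : ∀ (x : N) (m : M), (e + e') (x • m) = x • (e + e') m)
    (ξ : subgroupH1 N M) :
    resH1Hom (ContinuousMonoidHom.id N) (e + e') hee' ξ =
      resH1Hom (ContinuousMonoidHom.id N) e he ξ + resH1Hom (ContinuousMonoidHom.id N) e' he' ξ := by
  obtain ⟨f, rfl⟩ := oneCocycleClass_surjective _ ξ
  obtain ⟨g, hg, hgv⟩ := pushH1_oneCocycleClass (e + e') hee' f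
  obtain ⟨g₁, hg₁, hg₁v⟩ := pushH1_oneCocycleClass e he f
  obtain ⟨g₂, hg₂, hg₂v⟩ := pushH1_oneCocycleClass e' he' f
  rw [hg, hg₁, hg₂, ← oneCocycleClass_add]
  congr 1
  apply Subtype.ext; ext x
  rw [hgv, add_apply_val, hg₁v, hg₂v, AddMonoidHom.add_apply]

/-- `(id)_* = id`. [cite: SerreGaloisCohomology1997, I §2.4] -/
theorem pushH1_id_apply (hid : ∀ (x : N) (m : M), (AddMonoidHom.id M) (x • m) = x • (AddMonoidHom.id M) m) (ξ : subgroupH1 N M) :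
    resH1Hom (ContinuousMonoidHom.id N) (AddMonoidHom.id M) hid ξ = ξ := by
  rw [resH1Hom_congr rfl rfl hid (fun _ _ ↦ rfl), resH1Hom_id, AddMonoidHom.id_apply]

/-- `(e')_* ((e)_* ξ) = (e' ∘ e)_* ξ`. [cite: SerreGaloisCohomology1997, I §2.4] -/
theorem pushH1_comp_apply (e e' : M →+ M) (he : ∀ (x : N) (m : M), e (x • m) = x • e m)
    (he' : ∀ (x : N) (m : M), e' (x • m) = x • e' m) (hc : ∀ (x : N) (m : M), (e'.comp e) (x • m) = x • (e'.comp e) m)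
    (ξ : subgroupH1 N M) :
    resH1Hom (ContinuousMonoidHom.id N) e' he' (resH1Hom (ContinuousMonoidHom.id N) e he ξ) =
      resH1Hom (ContinuousMonoidHom.id N) (e'.comp e) hc ξ := by
  obtain ⟨f, rfl⟩ := oneCocycleClass_surjective _ ξ
  obtain ⟨g₁, hg₁, hg₁v⟩ := pushH1_oneCocycleClass e he f
  rw [hg₁]
  obtain ⟨g₂, hg₂, hg₂v⟩ := pushH1_oneCocycleClass e' he' g₁
  obtain ⟨g, hg, hgv⟩ := pushH1_oneCocycleClass (e'.comp e) hc f
  rw [hg₂, hg]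
  congr 1
  apply Subtype.ext; ext x
  rw [hg₂v, hg₁v, hgv, AddMonoidHom.comp_apply]

/-- If `e' ∘ e = 0` then `(e')_* ((e)_* ξ) = 0`. [cite: SerreGaloisCohomology1997, I §2.4] -/
theorem pushH1_pushH1_eq_zero (e e' : M →+ M) (he : ∀ (x : N) (m : M), e (x • m) = x • e m)
    (he' : ∀ (x : N) (m : M), e' (x • m) = x • e' m) (h0 : ∀ m : M, e' (e m) = 0) (ξ : subgroupH1 N M) :
    resH1Hom (ContinuousMonoidHom.id N) e' he' (resH1Hom (ContinuousMonoidHom.id N) e he ξ) = 0 := by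
  obtain ⟨f, rfl⟩ := oneCocycleClass_surjective _ ξ
  obtain ⟨g₁, hg₁, hg₁v⟩ := pushH1_oneCocycleClass e he f
  rw [hg₁]
  obtain ⟨g₂, hg₂, hg₂v⟩ := pushH1_oneCocycleClass e' he' g₁
  rw [hg₂]
  have h : g₂ = 0 := by
    apply Subtype.ext; ext x
    rw [hg₂v, hg₁v, h0]; rfl
  rw [h, oneCocycleClass_zero]

variable [N.Normal]

/-- ★ **Twisted naturality of conjugation: `c_* ∘ (e)_* = (e')_* ∘ c_*` when `e' (c • m) = c • e m`** (on cocycles both sides are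
`n ↦ c • e (f(c⁻¹ n c))`). [cite: SerreGaloisCohomology1997, I §2.5] [cite: NeukirchSchmidtWingberg2008, I §5] -/
theorem conjH1_pushH1 (c : G) (e e' : M →+ M) (he : ∀ (x : N) (m : M), e (x • m) = x • e m)
    (he' : ∀ (x : N) (m : M), e' (x • m) = x • e' m) (hce : ∀ m : M, e' (c • m) = c • e m) (ξ : subgroupH1 N M) :
    conjH1 N M c (resH1Hom (ContinuousMonoidHom.id N) e he ξ) = resH1Hom (ContinuousMonoidHom.id N) e' he' (conjH1 N M c ξ) := by
  obtain ⟨f, rfl⟩ := oneCocycleClass_surjective _ ξ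
  obtain ⟨g₁, hg₁, hg₁v⟩ := pushH1_oneCocycleClass e he f
  rw [hg₁, conjH1_oneCocycleClass, conjH1_oneCocycleClass]
  obtain ⟨g₂, hg₂, hg₂v⟩ := pushH1_oneCocycleClass e' he' (conjCocycle N c f)
  rw [hg₂]
  congr 1
  apply Subtype.ext; ext x
  rw [conjCocycle_apply, hg₁v, hg₂v, conjCocycle_apply, hce]

/-! ## §2. Complementary idempotents swapped by `c`: the `c_*`-fixed classes -/

/-- ★ **A `c_*`-fixed class decomposes as `ξ = (e₁)_* ξ + c_* ((e₁)_* ξ)`** when `e₁ + e₂ = id` and `e₂ (c • m) = c • e₁ m`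
(`ξ = (e₁)_*ξ + (e₂)_*ξ` and `(e₂)_* ξ = (e₂)_* (c_* ξ) = c_* ((e₁)_* ξ)`). [cite: SerreGaloisCohomology1997, I §2.5] -/
theorem eq_pushH1_add_conjH1_pushH1_of_conjH1_eq (c : G) (e₁ e₂ : M →+ M)
    (he₁ : ∀ (x : N) (m : M), e₁ (x • m) = x • e₁ m) (he₂ : ∀ (x : N) (m : M), e₂ (x • m) = x • e₂ m)
    (hsum : ∀ m : M, e₁ m + e₂ m = m) (hsw : ∀ m : M, e₂ (c • m) = c • e₁ m)
    {ξ : subgroupH1 N M} (hfix : conjH1 N M c ξ = ξ) :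
    ξ = resH1Hom (ContinuousMonoidHom.id N) e₁ he₁ ξ + conjH1 N M c (resH1Hom (ContinuousMonoidHom.id N) e₁ he₁ ξ) := by
  have hid : e₁ + e₂ = AddMonoidHom.id M := by ext m; exact hsum m
  have hee : ∀ (x : N) (m : M), (e₁ + e₂) (x • m) = x • (e₁ + e₂) m := fun x m ↦ by rw [hid]; rfl
  have h1 : ξ = resH1Hom (ContinuousMonoidHom.id N) (e₁ + e₂) hee ξ := by
    rw [resH1Hom_congr rfl hid hee (fun _ _ ↦ rfl), resH1Hom_id, AddMonoidHom.id_apply]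
  rw [conjH1_pushH1 c e₁ e₂ he₁ he₂ hsw, hfix]
  conv_lhs => rw [h1, pushH1_add_apply e₁ e₂ he₁ he₂ hee]

/-- ★ **Injectivity of `ξ ↦ (e₁)_* ξ` on the `c_*`-fixed classes.** [cite: SerreGaloisCohomology1997, I §2.5] -/
theorem eq_zero_of_conjH1_eq_of_pushH1_eq_zero (c : G) (e₁ e₂ : M →+ M)
    (he₁ : ∀ (x : N) (m : M), e₁ (x • m) = x • e₁ m) (he₂ : ∀ (x : N) (m : M), e₂ (x • m) = x • e₂ m)
    (hsum : ∀ m : M, e₁ m + e₂ m = m) (hsw : ∀ m : M, e₂ (c • m) = c • e₁ m)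
    {ξ : subgroupH1 N M} (hfix : conjH1 N M c ξ = ξ) (h0 : resH1Hom (ContinuousMonoidHom.id N) e₁ he₁ ξ = 0) : ξ = 0 := by
  rw [eq_pushH1_add_conjH1_pushH1_of_conjH1_eq c e₁ e₂ he₁ he₂ hsum hsw hfix, h0, map_zero, add_zero]

/-- ★ **Surjectivity: `η + c_* η` is `c_*`-fixed** for every `η ∈ H¹(N, M)` when `c² ∈ N` (inner automorphisms act trivially on `H¹(N, M)`).
[cite: SerreLocalFields1979, VII §5 Prop. 3] [cite: NeukirchSchmidtWingberg2008, (1.6.3)] -/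
theorem conjH1_add_conjH1_eq (c : G) (hcc : c * c ∈ N) (η : subgroupH1 N M) :
    conjH1 N M c (η + conjH1 N M c η) = η + conjH1 N M c η := by
  rw [map_add, ← AddMonoidHom.comp_apply, ← conjH1_mul_holds N M c c, conjH1_of_mem_holds N M hcc, AddMonoidHom.id_apply,
    add_comm]

/-- ★ **… and `(e₁)_* (η + c_* η) = η` for `η = (e₁)_* η'`**, when `e₁` is idempotent, `e₂ ∘ e₁ = 0` and `e₁ (c • m) = c • e₂ m` (the second swap):
`(e₁)_* (c_* ((e₁)_* η')) = c_* ((e₂)_* ((e₁)_* η')) = 0`. So `ξ ↦ (e₁)_* ξ` maps the `c_*`-fixed classes ONTO `range (e₁)_*`.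
[cite: SerreGaloisCohomology1997, I §2.5] -/
theorem pushH1_add_conjH1_eq (c : G) (e₁ e₂ : M →+ M)
    (he₁ : ∀ (x : N) (m : M), e₁ (x • m) = x • e₁ m) (he₂ : ∀ (x : N) (m : M), e₂ (x • m) = x • e₂ m)
    (hidem : ∀ m : M, e₁ (e₁ m) = e₁ m) (h21 : ∀ m : M, e₂ (e₁ m) = 0) (hsw' : ∀ m : M, e₁ (c • m) = c • e₂ m)
    (η' : subgroupH1 N M) :
    resH1Hom (ContinuousMonoidHom.id N) e₁ he₁
        (resH1Hom (ContinuousMonoidHom.id N) e₁ he₁ η' + conjH1 N M c (resH1Hom (ContinuousMonoidHom.id N) e₁ he₁ η')) =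
      resH1Hom (ContinuousMonoidHom.id N) e₁ he₁ η' := by
  have hcomp : e₁.comp e₁ = e₁ := by ext m; exact hidem m
  have hc11 : ∀ (x : N) (m : M), (e₁.comp e₁) (x • m) = x • (e₁.comp e₁) m := fun x m ↦ by rw [hcomp]; exact he₁ x m
  rw [map_add, ← conjH1_pushH1 c e₂ e₁ he₂ he₁ hsw', pushH1_pushH1_eq_zero e₁ e₂ he₁ he₂ h21, map_zero, add_zero,
    pushH1_comp_apply e₁ e₁ he₁ he₁ hc11, resH1Hom_congr rfl hcomp hc11 he₁]

end Summit.BirchSwinnertonDyer.BirchSwinnertonDyer.Theorems.SmallImageCharSignedSelmer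

end
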